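import Summits.CriticalPhenomena.PercolationContinuityZ3.Theorems.PercNearOneGluingNoHeavyQuantSliceClosedTargetFree
import Summits.CriticalPhenomena.PercolationContinuityZ3.Theorems.PercNearOneGluingNoHeavyQuantSliceHeavy
import HarnessLib

/-!
# QUANT lane R8, T-DEC: CONJECTURE SL (`LawDec.SliceClosed`) IS FALSE — an explicit four-atom counterexample, kernel-checked;
# hence also `¬ LawDec.SliceClosedT`

builds on p205010 (kernel theorem, internal audit signed; external expert review pending)

Refutation file (`--supports stmt-CriticalPhenomena-4575`), QUANT lane seat prim-quant-census-2 (gen 54), rung R8 of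
`run/shared/lean/prim/quant/LADDER.md`.  Memo `run/shared/lean/prim/quant/prim-quant-census-2-g54/SL-STRUCTURE-G54.md` §1.  Theorems only,
standard axioms, no sorries; every number below is an exact rational checked by `norm_num`.

THE COUNTEREXAMPLE (census-2 g54, found by an exact LP search over the "band atom + light straddler" geometry, then rounded to small
rationals).  Floor `x = 15/16`, law `ν = {2 ↦ 1/16, 4 ↦ 1/288, 6 ↦ 1/18, 8 ↦ 253/288}` on `{0..8}` (mass `1`, mean `T = 15/2`, top-affordable
with equality `x·8 = 15/2`), blob `(a, g) = (3, 15/16)` (`g = x`), layer `j′ = 6` (`a ≤ j′ < M + a`).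
* `ν` is DEC(6): `{2, 6; 239/256}` (light credit pair, credit `4 + 4·(239/256 − x²)/(1 − x) = 15/2 = T`) with weight `8/135`, `{2, 8; x}`
  (giant pair) with weight `253/270`, points `{4}`, `{6}` (`2k ≥ T`) — `slCex_decAt_six`.
* `ν` is DEC(3) (`= j′ − a`): `{2, 4; x}`, `{2, 6; x}`, `{2, 8; x}` — all giant pairs (`hi ≥ 4`), weights `1/270, 8/135, 253/270`; this is
  criterion E with equality (`x·ν 2 = (1 − x)·(ν 4 + ν 6 + ν 8)`) — `slCex_decAt_three`.
* the slice `μ = slice ν 3 (15/16)` = `{2 ↦ 1/256, 4 ↦ 1/4608, 5 ↦ 15/256, 6 ↦ 1/288, 7 ↦ 5/1536, 8 ↦ 253/4608, 9 ↦ 5/96, 11 ↦ 1265/1536}` has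
  mean `165/16`; at layer `6` its lows are `2, 4, 5` (`2p < 165/16`), its only mid is `6`, compatible only with the low `5` (`5 + 6 > 165/16 > 4 + 6`)
  at minimal gate `115/128` (usage `115/13`), and the giants `7, 8, 9, 11` absorb at rate `x/(1−x) = 15`.  The price system `α ≡ 345` on the lows,
  `β 6 = 39`, `β = 23` on the giants is feasible (`345 = 15·23 = (115/13)·39`) and has `Σ α μ(low) − Σ β μ(absorber) = 7/288 > 0`, contradicting
  weak duality `LawDec.dual_le_of_decAtT` — `slCex_slice_not_decAt`.  (Mass bookkeeping: the lows carry `289/4608`, the absorbers can take at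
  most `(4303/15 + 16·13/115)/4608 < 289/4608`.)
So `LawDec.SliceClosed` (g53, p266162; censuses ≈ 1.1 M layers / 0) fails — `not_sliceClosed` — and with it the target-free `LawDec.SliceClosedT`
(g54, p300198, via `sliceClosed_of_sliceClosedT`) — `not_sliceClosedT`.  The earlier censuses missed it because the mechanism needs, at once:
`g` at (or near) the floor, a high floor, a band atom `w` with `T ≤ 2w < T + ag` inside the window `(j′−a, j′]` carrying the pool capacity that
the layer-`(j′−a)` hypothesis consumes, and a deep low whose layer-`j′` absorber is a LIGHT straddler mid `m` with `l + m ≤ T + ag` (the pair dies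
at the raised target); then the row-1 copy of the low exhausts the giants and the row-0 lows `l`, `w` have nowhere to go.

WHAT SURVIVES (memo §2; exact LP, 0 failures so far — conjectures, not theorems): `ν` above is NOT DEC at layers 4, 5; in every counterexample
found the law fails DEC at some layer strictly between `j′ − a` and `j′`.  The induction that the lane actually needs (`blobDEC_of_sliceClosed`,
`TreeBuiltDEC`) only ever slices laws that are DEC at EVERY layer; the all-layers form "DEC at all layers ⟹ the slice is DEC at all layers"
has no known counterexample.  `BLOB-DEC(k)`, `Quant.TreeDEC`, `SDECConvClosed`, `TreeBuiltDEC` are untouched by this file.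

[this work]; DEC rules ARCH-TREES-G49 §2.2 / DEC-TAMP-G50 §3.1; `LawDec.SliceClosed` DEC-CLOSURE-G53 §4 (this lane).  The gluing rows served
[cite: KozmaNitzan2024, Conjecture 3 (p. 15)]; product measure [cite: Grimmett1999, §1.3 p. 10].
-/

noncomputable section

namespace Summit.CriticalPhenomena.PercolationContinuityZ3.Theorems

namespace Quant

open Finset

/-- the two-point law `{lo, hi; g}` (as in `…QuantLawDEC`) -/
local notation3 "TP[" lo ", " hi ", " g ", " h "]" =>
  (g : ℝ) * (if (h : ℕ) = (hi : ℕ) then (1 : ℝ) else 0) + (1 - (g : ℝ)) * (if (h : ℕ) = (lo : ℕ) then (1 : ℝ) else 0)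

namespace LawDec

/-! ### The law -/

/-- the counterexample law `ν = {2 ↦ 1/16, 4 ↦ 1/288, 6 ↦ 1/18, 8 ↦ 253/288}`. [this work] -/
def slCex : ℕ → ℝ := fun h =>
  if h = 2 then 1 / 16 else if h = 4 then 1 / 288 else if h = 6 then 1 / 18 else if h = 8 then 253 / 288 else 0

/-- `ν ≥ 0`. [this work] -/
theorem slCex_nonneg (h : ℕ) : 0 ≤ slCex h := by
  unfold slCex; split_ifs <;> norm_num

/-- `ν` vanishes above `8`. [this work] -/
theorem slCex_eq_zero (h : ℕ) (hh : 8 < h) : slCex h = 0 := by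
  unfold slCex
  rw [if_neg (by omega), if_neg (by omega), if_neg (by omega), if_neg (by omega)]

/-- `ν` has mass `1` on `{0..8}`. [this work] -/
theorem slCex_sum : ∑ h ∈ Finset.range (8 + 1), slCex h = 1 := by
  simp only [Finset.sum_range_succ, Finset.sum_range_zero, slCex]
  norm_num

/-- `ν` has mean `15/2`. [this work] -/
theorem slCex_mean : ∑ h ∈ Finset.range (8 + 1), (h : ℝ) * slCex h = 15 / 2 := by
  simp only [Finset.sum_range_succ, Finset.sum_range_zero, slCex]
  norm_num

/-- the values of `slCex` off and on its support, for case analysis on a symbolic atom. [folklore] -/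
theorem slCex_cases (h : ℕ) :
    h = 2 ∨ h = 4 ∨ h = 6 ∨ h = 8 ∨ (h ≠ 2 ∧ h ≠ 4 ∧ h ≠ 6 ∧ h ≠ 8) := by omega

/-! ### DEC at layer 6 (the layer `j′`) -/

/-- `ν` is DEC(6) at floor `15/16` and target `15/2` (its mean): light pair `{2,6;239/256}`, giant pair `{2,8;15/16}`, points `4`, `6`.
[this work] -/
theorem slCex_decAtT_six : DECAtT (15 / 16) (15 / 2) 6 8 slCex := by
  refine decAtT_finite_mixture (ι := Fin 4) (15 / 16) (15 / 2) 6 8 slCex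
    ![8 / 135, 253 / 270, 1 / 288, 1 / 4320]
    ![fun h => TP[2, 6, (239 / 256 : ℝ), h], fun h => TP[2, 8, (15 / 16 : ℝ), h], fun h => TP[4, 4, (0 : ℝ), h],
      fun h => TP[6, 6, (0 : ℝ), h]]
    ?_ ?_ ?_ ?_
  · intro i; fin_cases i <;> norm_num
  · simp only [Fin.sum_univ_four, Matrix.cons_val_zero, Matrix.cons_val_one, Matrix.cons_val]; norm_num
  · intro h
    simp only [Fin.sum_univ_four, Matrix.cons_val_zero, Matrix.cons_val_one, Matrix.cons_val]
    rcases slCex_cases h with rfl | rfl | rfl | rfl | ⟨h2, h4, h6, h8⟩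
    · norm_num [slCex]
    · norm_num [slCex]
    · norm_num [slCex]
    · norm_num [slCex]
    · simp [slCex, h2, h4, h6, h8]
  · intro i _
    fin_cases i
    · refine decAtT_single (15 / 16) (15 / 2) 6 8 2 6 (239 / 256) (by norm_num) (by norm_num) (by norm_num) ?_
      refine Or.inr (Or.inr ⟨by norm_num, by norm_num, ?_⟩)
      rw [if_neg (by norm_num)]
      norm_num
    · exact decAtT_single (15 / 16) (15 / 2) 6 8 2 8 (15 / 16) (by norm_num) (by norm_num) (by norm_num)
        (Or.inr (Or.inl ⟨by norm_num, by norm_num, le_rfl⟩))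
    · exact decAtT_single (15 / 16) (15 / 2) 6 8 4 4 0 (by norm_num) le_rfl (by norm_num)
        (Or.inl ⟨rfl, Or.inl (by norm_num)⟩)
    · exact decAtT_single (15 / 16) (15 / 2) 6 8 6 6 0 (by norm_num) le_rfl (by norm_num)
        (Or.inl ⟨rfl, Or.inl (by norm_num)⟩)

/-- `ν` is DEC(6) at its own mean (`LawDec.DECAt`). [this work] -/
theorem slCex_decAt_six : DECAt (15 / 16) 6 8 slCex := by
  rw [decAt_iff_decAtT, slCex_mean]; exact slCex_decAtT_six

/-! ### DEC at layer 3 (the layer `j′ − a`) -/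

/-- `ν` is DEC(3) at floor `15/16` and target `15/2`: giant pairs `{2,4;x}`, `{2,6;x}`, `{2,8;x}` (criterion E, tight). [this work] -/
theorem slCex_decAtT_three : DECAtT (15 / 16) (15 / 2) 3 8 slCex := by
  refine decAtT_finite_mixture (ι := Fin 3) (15 / 16) (15 / 2) 3 8 slCex
    ![1 / 270, 8 / 135, 253 / 270]
    ![fun h => TP[2, 4, (15 / 16 : ℝ), h], fun h => TP[2, 6, (15 / 16 : ℝ), h], fun h => TP[2, 8, (15 / 16 : ℝ), h]]
    ?_ ?_ ?_ ?_
  · intro i; fin_cases i <;> norm_num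
  · simp only [Fin.sum_univ_three, Matrix.cons_val_zero, Matrix.cons_val_one, Matrix.cons_val]; norm_num
  · intro h
    simp only [Fin.sum_univ_three, Matrix.cons_val_zero, Matrix.cons_val_one, Matrix.cons_val]
    rcases slCex_cases h with rfl | rfl | rfl | rfl | ⟨h2, h4, h6, h8⟩
    · norm_num [slCex]
    · norm_num [slCex]
    · norm_num [slCex]
    · norm_num [slCex]
    · simp [slCex, h2, h4, h6, h8]
  · intro i _
    fin_cases i
    · exact decAtT_single (15 / 16) (15 / 2) 3 8 2 4 (15 / 16) (by norm_num) (by norm_num) (by norm_num)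
        (Or.inr (Or.inl ⟨by norm_num, by norm_num, le_rfl⟩))
    · exact decAtT_single (15 / 16) (15 / 2) 3 8 2 6 (15 / 16) (by norm_num) (by norm_num) (by norm_num)
        (Or.inr (Or.inl ⟨by norm_num, by norm_num, le_rfl⟩))
    · exact decAtT_single (15 / 16) (15 / 2) 3 8 2 8 (15 / 16) (by norm_num) (by norm_num) (by norm_num)
        (Or.inr (Or.inl ⟨by norm_num, by norm_num, le_rfl⟩))

/-- `ν` is DEC(3) at its own mean. [this work] -/
theorem slCex_decAt_three : DECAt (15 / 16) 3 8 slCex := by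
  rw [decAt_iff_decAtT, slCex_mean]; exact slCex_decAtT_three

/-! ### The slice is not DEC at layer 6 -/

/-- the slice `μ = slice ν 3 (15/16)`: its mean. [this work] -/
theorem slCex_slice_mean : ∑ h ∈ Finset.range (11 + 1), (h : ℝ) * slice slCex 3 (15 / 16) h = 165 / 16 := by
  simp only [Finset.sum_range_succ, Finset.sum_range_zero, slice, slCex]
  norm_num

/-- prices of the violating certificate: `α ≡ 345` on the lows `2, 4, 5`. [this work] -/
def slCexα : ℕ → ℝ := fun l => if l = 2 ∨ l = 4 ∨ l = 5 then 345 else 0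

/-- prices of the violating certificate: `β 6 = 39` (the mid), `β = 23` on the giants `≥ 7`. [this work] -/
def slCexβ : ℕ → ℝ := fun h => if h = 6 then 39 else if 7 ≤ h then 23 else 0

/-- **the slice of `ν` by the blob `(3, 15/16)` is NOT DEC(6) at floor `15/16` and its mean `165/16`**: the price system
`(slCexα, slCexβ)` is feasible for `LawDec.dual_le_of_decAtT` and violates its conclusion by `7/288`. [this work] -/
theorem slCex_slice_not_decAtT : ¬ DECAtT (15 / 16) (165 / 16) 6 11 (slice slCex 3 (15 / 16)) := by
  intro hdec
  have key := dual_le_of_decAtT (15 / 16) (165 / 16) 6 11 (slice slCex 3 (15 / 16)) (by norm_num) (by norm_num) hdec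
    slCexα slCexβ (fun h => by unfold slCexβ; split_ifs <;> norm_num) ?_
  · revert key
    simp only [Finset.sum_range_succ, Finset.sum_range_zero, slice, slCex, slCexα, slCexβ]
    norm_num
  · intro l h hl hlT hh hcomp
    have hl5 : l ≤ 5 := by
      by_contra hl6
      have : (6 : ℝ) ≤ l := by exact_mod_cast (by omega : 6 ≤ l)
      linarith
    by_cases h7 : 7 ≤ h
    · -- a giant: usage `x/(1−x) = 15`
      have hu : usage (15 / 16) (165 / 16) 6 l h = 15 := by
        simp only [usage, gateOf, if_pos h7]; norm_num
      rw [hu]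
      simp only [slCexα, slCexβ, if_neg (show ¬ h = 6 by omega), if_pos h7]
      split_ifs <;> norm_num
    · -- a mid: the only compatible pair is `(5, 6)`
      have hc : (165 / 16 : ℝ) < l + h := hcomp.resolve_left h7
      have h11 : 11 ≤ l + h := by
        by_contra hlt
        have : ((l + h : ℕ) : ℝ) ≤ 10 := by exact_mod_cast (by omega : l + h ≤ 10)
        push_cast at this
        linarith
      obtain ⟨rfl, rfl⟩ : l = 5 ∧ h = 6 := by omega
      simp only [slCexα, slCexβ, usage, gateOf, pairGate]
      norm_num [max_def]

/-- at its own mean: the slice is not `LawDec.DECAt` at layer `6`. [this work] -/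
theorem slCex_slice_not_decAt : ¬ DECAt (15 / 16) 6 (8 + 3) (slice slCex 3 (15 / 16)) := by
  rw [decAt_iff_decAtT, slCex_slice_mean]
  exact slCex_slice_not_decAtT

/-! ### The refutations -/

/-- **CONJECTURE SL (`LawDec.SliceClosed`, census-2 g53) IS FALSE.**  Witness: floor `x = 15/16`, gate `g = 15/16`, `M = 8`, `a = 3`,
`j′ = 6`, law `slCex` (nonnegative, supported on `{0..8}`, mass `1`, top-affordable, DEC at layers `6` and `3`), whose slice is not DEC(6).
[this work] -/
theorem not_sliceClosed : ¬ SliceClosed := by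
  intro hSL
  refine slCex_slice_not_decAt (hSL (15 / 16) (15 / 16) 8 3 6 slCex (by norm_num) le_rfl (by norm_num) (by norm_num)
    slCex_nonneg slCex_eq_zero slCex_sum ?_ (by norm_num) slCex_decAt_six (fun _ => slCex_decAt_three))
  -- top-affordability: charged atoms are `≤ 8` and `x·8 = 15/2 = mean`
  intro h hh
  rw [slCex_mean]
  have h8 : h ≤ 8 := by
    by_contra h9
    exact absurd (slCex_eq_zero h (by omega)) (ne_of_gt hh)
  have : (h : ℝ) ≤ 8 := by exact_mod_cast h8
  linarith

/-- **the target-free form `LawDec.SliceClosedT` (census-2 g54) is FALSE as well** (it implies `SliceClosed`). [this work] -/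
theorem not_sliceClosedT : ¬ SliceClosedT := fun h => not_sliceClosed (sliceClosed_of_sliceClosedT h)

end LawDec

end Quant

end Summit.CriticalPhenomena.PercolationContinuityZ3.Theorems
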